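import Summits.BirchSwinnertonDyer.BirchSwinnertonDyer.Theorems.SignedLowerHalvesKobayashiMainConjectureSmallImageRationalRigidity
import HarnessLib

/-!
# Crux `KobayashiMainConjectureSmallImage` (item stmt-BirchSwinnertonDyer-19002), line «acns»:
# the anticyclotomic ANCHOR is also needed only RATIONALLY — `(G⁻)` is saturated under nonzero
# constants once `μ(G⁻) = 0` (ideator bsd-idea-13 gen 5, planner-bsd-idea-13-g5-0, 2026-08-28;
# crux WORKFILE: pure commutative algebra, sorry-free; nothing about any curve is asserted; no line is
# registered or re-pointed (W-71/W-79); BSD is not proved by this seat)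

CONTEXT. The lead's `…Theorems.SmallImageRationalRigidity.le_span_of_anchor_rat` (landed 2026-08-28)
derives the integral Eisenstein inclusion `I ⊆ (G)` in `𝒪_{ℂ_p}⟦T₂⟧⟦T₁⟧` from the RATIONAL two-variable
Euler-system inclusion `β·G ∈ I` (T2 up to a nonzero constant — the shape Rubin's Thm. 2.3.3 yields at
non-split-Cartan image, where no `τ` with `T/(τ-1)T` free of rank one exists), the INTEGRAL anticyclotomic
anchor `I|_{T₁=0} ⊆ (G⁻)` (T1) and `μ(G⁻) = 0`.

THIS FILE removes the last integrality demand: with `μ(G⁻) = 0` the anchor may ALSO be fed up to a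
nonzero constant `β'` (`β'·I|_{T₁=0} ⊆ (G⁻)`, e.g. `β' = p^b` — the shape a Λ-adic Kolyvagin-system
argument run at prime-to-`p` image produces, its error terms `H¹(K(E[p^k])/K, E[p^k])` being bounded, not
zero). The mechanism is one application of the lead's ONE-variable Gauss inequality
(`SmallImageGaussInequality.norm_coeff_mul_norm_coeff_le₁`): if `β'·x = G⁻·m` then every coefficient of
`G⁻·m` has norm `≤ ‖β'‖`, so a unit coefficient of `G⁻` forces `‖m_n‖ ≤ ‖β'‖` for all `n`, i.e.
`β' ∣ m` in the valuation ring `𝒪_{ℂ_p}`, whence `x = G⁻·(m/β') ∈ (G⁻)`: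

* `mem_span_of_C_mul_mem_span` — **saturation**: `HasUnitContent G₀`, `β' ≠ 0`, `C β' * x ∈ (G₀)` ⇒ `x ∈ (G₀)`;
* `le_span_of_anchor_rat_rat` — the lead's rigidity with BOTH inclusions rational:
  `β·G ∈ I`, `∀ x ∈ I|_{T₁=0}, β'·x ∈ (G₀)`, `μ(G₀) = 0` ⇒ `I ⊆ (G)`;
* `map_le_span_of_anchor_rat_rat`, `map_le_span_of_anchor_natCast_pow_pow` — the same in the K1″
  receptacle `I·𝒪⟦T₁,T₂⟧` along a structure map `J` (drop-in variants of the lead's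
  `map_le_span_of_anchor_rat` / `map_le_span_of_anchor_natCast_pow` with the anchor hypothesis weakened).

READING for the line (numbers, not adjectives): on «acns» at `p ≥ 5` NEITHER engine statement (T1, T2) has
to be integral; the by-name fact `μ(𝓛_p^{Gr}(f/K)⁻) = 0` [BurungaleCastellaSkinner2025, Prop. 4.2.2]
absorbs every `p`-power ambiguity of the small-image Euler/Kolyvagin-system arguments. What small image
still costs is therefore located OUTSIDE `(p)`: Λ-primitivity of the Heegner-point Kolyvagin system at the
height-one primes `≠ (p)` (T1's engine) — unchanged by this file. 0 stubs closed; crux 4 OPEN.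

References: [Rubin2000] Thm. 2.3.3; [BourbakiAC5to7] VII §3 (Gauss's lemma over a valuation ring, here via
the lead's rescaling inequality); [BurungaleCastellaSkinner2025] Prop. 4.2.2; [Howard2004Duke] Thm. A (the Λ-adic
Heegner-point Kolyvagin-system bound, stated at surjective image, whose small-image rerun is expected to
carry a `p^b`).
-/

-- D-0017: single-problem summit, the namespace repeats the problem name by design.
set_option linter.dupNamespace false
set_option autoImplicit false

noncomputable section

open scoped Classical

namespace Summit.BirchSwinnertonDyer.BirchSwinnertonDyer.Cruxes.KobayashiMainConjectureSmallImage.RatAnchorSaturation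

open PowerSeries Literature.NumberTheory.EllipticCurves Literature.NumberTheory.EllipticCurves.GreenbergVatsal2000
  Literature.NumberTheory.EllipticCurves.UnrSeries₂
  Summit.BirchSwinnertonDyer.BirchSwinnertonDyer.Theorems.SmallImageGaussInequality
  Summit.BirchSwinnertonDyer.BirchSwinnertonDyer.Theorems.SmallImageRationalRigidity

variable {p : ℕ} [Fact p.Prime]

/-! ## §1 Saturation of `(G₀)` under nonzero constants when `μ(G₀) = 0` -/

/-- **Saturation.** In `𝒪_{ℂ_p}⟦T⟧`: if `G₀` has UNIT CONTENT (`μ(G₀) = 0`), `β' ∈ 𝒪_{ℂ_p}` is a nonzero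
constant and `β'·x ∈ (G₀)`, then `x ∈ (G₀)`. Proof: `β' x = G₀ m`; every coefficient of `G₀ m` has norm
`≤ ‖β'‖`; the one-variable Gauss inequality at a unit coefficient of `G₀` gives `‖m_n‖ ≤ ‖β'‖`, so
`m = β' m'` and `x = G₀ m'` (domain). [folklore]
[cite: BourbakiAC5to7, Ch. VII §3 (Gauss's lemma; here the lead's rescaling form over 𝒪_{ℂ_p})] -/
theorem mem_span_of_C_mul_mem_span {G₀ x : PowerSeries (PadicComplexInt p)} (hμ : HasUnitContent G₀)
    {β' : PadicComplexInt p} (hβ' : β' ≠ 0) (hx : C β' * x ∈ Ideal.span {G₀}) :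
    x ∈ Ideal.span {G₀} := by
  obtain ⟨m, hm⟩ := Ideal.mem_span_singleton'.mp hx
  -- hm : m * G₀ = C β' * x
  obtain ⟨n₀, hn₀⟩ := hμ
  -- every coefficient of `G₀ * m = β' x` has norm `≤ ‖β'‖`
  have hb : ∀ j, ‖((coeff j (G₀ * m) : PadicComplexInt p) : ℂ_[p])‖ ≤ ‖(β' : ℂ_[p])‖ := by
    intro j
    rw [mul_comm, hm, coeff_C_mul]
    push_cast
    rw [norm_mul]
    exact mul_le_of_le_one_right (norm_nonneg _) (norm_coe_padicComplexInt_le_one _)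
  -- Gauss at the unit coefficient `n₀` of `G₀`: `‖m_n‖ ≤ ‖β'‖`
  have key : ∀ n, ‖((coeff n m : PadicComplexInt p) : ℂ_[p])‖ ≤ ‖(β' : ℂ_[p])‖ := by
    intro n
    have h1 := norm_coeff_mul_norm_coeff_le₁ G₀ m hb n₀ n
    rwa [isUnit_padicComplexInt_iff.mp hn₀, one_mul] at h1
  have hdvd : ∀ n, β' ∣ coeff n m := fun n ↦ padicComplexInt_dvd_of_norm_le (key n)
  choose q hq using hdvd
  set m' : PowerSeries (PadicComplexInt p) := PowerSeries.mk q with hm'def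
  have hmm' : m = C β' * m' := by
    refine PowerSeries.ext fun n ↦ ?_
    rw [coeff_C_mul, hm'def, coeff_mk]
    exact hq n
  have hC : (C β' : PowerSeries (PadicComplexInt p)) ≠ 0 := by
    intro h0
    apply hβ'
    simpa using congr_arg (constantCoeff (R := PadicComplexInt p)) h0
  -- cancel `β'`: `x = G₀ * m'`
  have e1 : C β' * x = C β' * (m' * G₀) := by rw [← hm, hmm']; ring
  have e2 : x = m' * G₀ := mul_left_cancel₀ hC e1
  exact Ideal.mem_span_singleton'.mpr ⟨m', e2.symm⟩

/-- Ideal form of the saturation: if `β'·J ⊆ (G₀)` elementwise, `β' ≠ 0`, `μ(G₀) = 0`, then `J ⊆ (G₀)`.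
[folklore] [cite: BourbakiAC5to7, Ch. VII §3 (Gauss's lemma)] -/
theorem le_span_of_forall_C_mul_mem {J : Ideal (PowerSeries (PadicComplexInt p))}
    {G₀ : PowerSeries (PadicComplexInt p)} (hμ : HasUnitContent G₀) {β' : PadicComplexInt p} (hβ' : β' ≠ 0)
    (h : ∀ x ∈ J, C β' * x ∈ Ideal.span {G₀}) : J ≤ Ideal.span {G₀} :=
  fun x hx ↦ mem_span_of_C_mul_mem_span hμ hβ' (h x hx)

/-- The `p^b`-form of the saturation (the text a small-image Kolyvagin-system bound produces):
`p^b · x ∈ (G₀)`, `μ(G₀) = 0` ⇒ `x ∈ (G₀)`. [folklore] [cite: BourbakiAC5to7, Ch. VII §3 (Gauss's lemma)] -/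
theorem mem_span_of_natCast_pow_mul_mem_span {G₀ x : PowerSeries (PadicComplexInt p)} (hμ : HasUnitContent G₀)
    (b : ℕ) (hx : ((p : ℕ) : PowerSeries (PadicComplexInt p)) ^ b * x ∈ Ideal.span {G₀}) :
    x ∈ Ideal.span {G₀} := by
  have hβ : (p : PadicComplexInt p) ^ b ≠ 0 := pow_ne_zero _ natCast_p_ne_zero
  have hC : (C ((p : PadicComplexInt p) ^ b) : PowerSeries (PadicComplexInt p)) =
      ((p : ℕ) : PowerSeries (PadicComplexInt p)) ^ b := by
    rw [map_pow, map_natCast]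
  exact mem_span_of_C_mul_mem_span hμ hβ (hC ▸ hx)

/-! ## §2 Rigidity with BOTH inclusions rational -/

/-- **Doubly-rational rigidity off the anticyclotomic line.** In `𝒪_{ℂ_p}⟦T₂⟧⟦T₁⟧`: `I` principal,
`β·G ∈ I` (rational Euler-system inclusion, `β ≠ 0` constant), the anchor UP TO A CONSTANT
`∀ x ∈ I|_{T₁=0}, β'·x ∈ (G(0,·))` (`β' ≠ 0`), and `μ(G(0,·)) = 0` ⇒ `I ⊆ (G)`. The lead's
`SmallImageRationalRigidity.le_span_of_anchor_rat` is the case `β' = 1`; the saturation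
`mem_span_of_C_mul_mem_span` reduces to it. [folklore]
[cite: Rubin2000, Thm. 2.3.3 (the p^t-shape of Euler-system bounds without the τ-hypothesis)]
[cite: BurungaleCastellaSkinner2025, Prop. 4.2.2 (§4.2, p. 9 of arXiv:2405.00270v2) (the μ-input by name)] -/
theorem le_span_of_anchor_rat_rat
    {I : Ideal (PowerSeries (PowerSeries (PadicComplexInt p)))} {G : PowerSeries (PowerSeries (PadicComplexInt p))}
    (hI : I.IsPrincipal) {β β' : PadicComplexInt p} (hβ : β ≠ 0) (hβ' : β' ≠ 0) (hG : C (C β) * G ∈ I)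
    (hanch : ∀ x ∈ I.map (constantCoeff (R := PowerSeries (PadicComplexInt p))),
      C β' * x ∈ Ideal.span {constantCoeff (R := PowerSeries (PadicComplexInt p)) G})
    (hμ : HasUnitContent (constantCoeff (R := PowerSeries (PadicComplexInt p)) G)) :
    I ≤ Ideal.span {G} :=
  le_span_of_anchor_rat hI hβ hG (le_span_of_forall_C_mul_mem hμ hβ' hanch) hμ

/-- **In the K1″ receptacle** (drop-in for the lead's `map_le_span_of_anchor_rat` with the anchor weakened to
"up to the nonzero constant `β'`"): `β·G ∈ I·𝒪⟦T₁,T₂⟧`, `∀ x ∈ (I·𝒪⟦T₁,T₂⟧)|_{T₁=0}, β'·x ∈ (G⁻)`,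
`μ(G⁻) = 0` ⇒ `I·𝒪⟦T₁,T₂⟧ ⊆ (G)`. [folklore]
[cite: BurungaleCastellaSkinner2025, Prop. 4.2.2 (§4.2, p. 9 of arXiv:2405.00270v2)]
[cite: BurungaleSkinnerTianWan2024, Thm. 9.24 (the Eisenstein-direction conclusion shape of K1″)] -/
theorem map_le_span_of_anchor_rat_rat {I : Ideal (IwasawaAlgebra₂ p)} (hI : I.IsPrincipal)
    (J : ℤ_[p] →+* PadicComplexInt p) {G : PowerSeries (PowerSeries (PadicComplexInt p))}
    {β β' : PadicComplexInt p} (hβ : β ≠ 0) (hβ' : β' ≠ 0)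
    (hES : C (C β) * G ∈ I.map (IwasawaAlgebra₂.toUnr₂ p J))
    (hμ : HasUnitContent (UnrSeries₂.minus G))
    (hanch : ∀ x ∈ (I.map (IwasawaAlgebra₂.toUnr₂ p J)).map
        (PowerSeries.constantCoeff (R := PowerSeries (PadicComplexInt p))),
      C β' * x ∈ Ideal.span {UnrSeries₂.minus G}) :
    I.map (IwasawaAlgebra₂.toUnr₂ p J) ≤ Ideal.span {G} :=
  map_le_span_of_anchor_rat hI J hβ hES hμ (le_span_of_forall_C_mul_mem hμ hβ' hanch)

/-- **The `p^a` / `p^b` form** (both engine texts as a small-image argument delivers them):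
`(p^a·G) ⊆ I·𝒪⟦T₁,T₂⟧`, `∀ x ∈ (I·𝒪⟦T₁,T₂⟧)|_{T₁=0}, p^b·x ∈ (G⁻)`, `μ(G⁻) = 0` ⇒ `I·𝒪⟦T₁,T₂⟧ ⊆ (G)`.
[folklore] [cite: Rubin2000, Thm. 2.3.3] [cite: BurungaleCastellaSkinner2025, Prop. 4.2.2 (§4.2, p. 9 of arXiv:2405.00270v2)] -/
theorem map_le_span_of_anchor_natCast_pow_pow {I : Ideal (IwasawaAlgebra₂ p)} (hI : I.IsPrincipal)
    (J : ℤ_[p] →+* PadicComplexInt p) {G : PowerSeries (PowerSeries (PadicComplexInt p))} (a b : ℕ)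
    (hES : Ideal.span {((p : ℕ) : PowerSeries (PowerSeries (PadicComplexInt p))) ^ a * G} ≤
      I.map (IwasawaAlgebra₂.toUnr₂ p J))
    (hμ : HasUnitContent (UnrSeries₂.minus G))
    (hanch : ∀ x ∈ (I.map (IwasawaAlgebra₂.toUnr₂ p J)).map
        (PowerSeries.constantCoeff (R := PowerSeries (PadicComplexInt p))),
      ((p : ℕ) : PowerSeries (PadicComplexInt p)) ^ b * x ∈ Ideal.span {UnrSeries₂.minus G}) :
    I.map (IwasawaAlgebra₂.toUnr₂ p J) ≤ Ideal.span {G} :=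
  map_le_span_of_anchor_natCast_pow hI J a hES hμ
    (fun x hx ↦ mem_span_of_natCast_pow_mul_mem_span hμ b (hanch x hx))

end Summit.BirchSwinnertonDyer.BirchSwinnertonDyer.Cruxes.KobayashiMainConjectureSmallImage.RatAnchorSaturation

end
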